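import Mathlib
import HarnessLib
import Literature.MathematicalPhysics.QuantumLattice.HubbardUVSymbolCTDifferences
import Literature.MathematicalPhysics.QuantumLattice.MatsubaraShiftedEnvelopeSums
import Literature.MathematicalPhysics.QuantumLattice.HubbardUVSymbolBandIncrements

/-!
# The padded ultraviolet grid symbol of a GENERAL band, `G_e(q₀,q⃗) = (βL²)⁻²Ψ(ω̃_{q₀}, e(q⃗))·[val q₀ < 2M]`, on the space–time dual
# torus `(ℤ/N) × (ℤ/L)²`: telescoping in the band, space differences through the padding, and the two `ℓ²` GRID SUMS
# (no time difference / one time difference) from fibrewise bounds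

Topic `MathematicalPhysics/QuantumLattice`; continues `HubbardUVSymbolCTDifferences` (k3c4-p2: the case `e = e_K`,
`gridSymbol L M N β (uvSymbolCT L M β μ K Λ) σ`; `gridFreq`, `sum_sum_window_eq`, `sum_inv_uvEnv_pow_le`) and
`MatsubaraShiftedEnvelopeSums` (`sum_inv_uvEnvShift_pow_le`).  For the first SPACE moments of the scale-`0` covariance of a framed
band the symbol is telescoped over the frame pieces, `G_{e_K} = G_{b_{-1}} + Σₘ (G_{bₘ} − G_{b_{m-1}})` (Benfatto–Giuliani–Mastropietro
2006, §3 (3.2)–(3.8)); each piece is fed to the weighted Plancherel inequality with a monomial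
(`TorusFourierWeightedL1ProdMoment.sum_sum_monomial_mul_norm_prodChar_le_prodWeight`), which needs the `ℓ²` norms over the grid of
`Δ_u^{t}(Δ_{e_l}^aΔ_{e_{l'}}^b G)` for `t ∈ {0,1}` time differences.  Here, for ANY band `e : (ℤ/L)² → ℝ`:

* `uvGridSymbolBand L M N β Λ e`; **`gridSymbol_uvSymbolCT_eq_uvGridSymbolBand`** (`e = nambuXiCT L μ K` recovers k3c4-p2's symbol);
* `fwdDiff_iter_zero_fun`, `fwdDiff_iter_sub`, `fwdDiff_iter₂_sub`, **`spaceDiff_uvGridSymbolBand`**, **`spaceDiff_uvGridSymbolBand_sub`**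
  — space differences act inside the window, the padding is untouched;
* **`sum_sum_wt_norm_charSum_telescope_le`** — the weighted `ℓ¹` norm of the character sum `S[G](a,b⃗) = Σ χχ·G` is subadditive along
  a telescoping sequence of symbols;
* the abstract grid function `T(q₀) = [val q₀ < 2M]·c²·F(ω̃_{q₀})` of a frequency-indexed lattice family `F`:
  **`sum_sum_norm_sq_window_le`** (`Σ_{q₀,q⃗}‖T‖² ≤ L²c⁴A²·4·(2β/Λ)` from `‖F(ω)‖ ≤ A·2/max(|ω|,Λ/2)`) and
  **`sum_sum_norm_sq_timeDiff_window_le`** (`Σ_{q₀,q⃗}‖T(q₀+u) − T(q₀)‖² ≤ L²c⁴(A′²·4(4·2β/Λ + 4(2/Λ)²) + 4A²(2/max(π(2M−1)/β,Λ/2))²)`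
  from the interior increment bound `‖F(ω+2π/β) − F(ω)‖ ≤ A′·2/max(|ω| − 2π/β, Λ/2)` and the value bound at the two edge rows
  `val q₀ ∈ {2M−1, N−1}`; `card_filter_val_eq_le_one`, `card_filter_val_add_eq_le_one`, `abs_gridFreq_edge`).

Everything is proved; `uvGridSymbolBand` is the only definition; no named facts.

## Sources

G. Benfatto, A. Giuliani, V. Mastropietro, Ann. Henri Poincaré 7 (2006) 809–898, §2.1 (2.3), (2.36aa), footnote ¹, §3 (3.2)–(3.8)
(`BenfattoGiulianiMastropietro2006`); M. Salmhofer, *Renormalization* (1999), §4.2.4 (4.63), §4.2.5 (4.70) (`Salmhofer1999`).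
-/

noncomputable section

namespace Literature.MathematicalPhysics.QuantumLattice

open Literature.Probability.LatticeModels Finset Complex

variable {L M N : ℕ}

/-! ### §1 The padded grid symbol of a band -/

/-- **The padded ultraviolet grid symbol of the band `e`**: `G_e(q₀,q⃗) = (βL²)⁻²·Ψ_{βL²,Λ}(ω̃_{q₀}, e(q⃗))` for `val q₀ < 2M`, `0` in the
padding (`Ψ_{c,Λ} = uvSymbol₂ c Λ` on the frequency–band plane, `ω̃ = gridFreq`). [cite: BenfattoGiulianiMastropietro2006, §2.1 (2.3) and footnote ¹] -/
def uvGridSymbolBand (L M N : ℕ) (β Λ : ℝ) (e : TorusSite 2 L → ℝ) (q₀ : TorusSite 1 N) (qv : TorusSite 2 L) : ℂ :=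
  if (q₀ 0).val < 2 * M then
    ((1 / (β * (L : ℝ) ^ 2) : ℝ) : ℂ) ^ 2 * uvSymbol₂ (β * (L : ℝ) ^ 2) Λ (fbPt (gridFreq M N β q₀) (e qv))
  else 0

/-- **The counterterm carrier's padded symbol is the grid symbol of its band `e_K`** (both Nambu labels).
[cite: BenfattoGiulianiMastropietro2006, §2.1 (2.3)] -/
theorem gridSymbol_uvSymbolCT_eq_uvGridSymbolBand [NeZero L] [NeZero M] [NeZero N] {β : ℝ} (hβ : 0 < β) (μ : ℝ) (K : TrigPolyC4v)
    (Λ : ℝ) (σ : Fin 2) :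
    gridSymbol L M N β (uvSymbolCT L M β μ K Λ) σ = uvGridSymbolBand L M N β Λ (nambuXiCT L μ K) := by
  funext q₀ qv
  rw [gridSymbol_uvSymbolCT_eq hβ, uvGridSymbolBand]
  split_ifs with h
  · rw [uvSymbol₂_fbPt]
  · rfl

/-! ### §2 Differences: constants, zero, subtraction -/

section Diff

variable {X : Type*} [AddCommGroup X]

/-- Iterated differences of the zero function vanish. [cite: BenfattoGiulianiMastropietro2006, (2.36aa)] -/
theorem fwdDiff_iter_zero_fun (v : X) : ∀ n : ℕ, (fwdDiff v)^[n] (fun _ : X => (0 : ℂ)) = fun _ => 0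
  | 0 => rfl
  | n + 1 => by
    rw [Function.iterate_succ_apply]
    have h : fwdDiff v (fun _ : X => (0 : ℂ)) = fun _ => 0 := by funext x; simp [fwdDiff]
    rw [h, fwdDiff_iter_zero_fun v n]

/-- Iterated differences are additive: `(Δ_v)ⁿ(F − G) = (Δ_v)ⁿF − (Δ_v)ⁿG`. [cite: BenfattoGiulianiMastropietro2006, (2.36aa)] -/
theorem fwdDiff_iter_sub (v : X) : ∀ (n : ℕ) (F G : X → ℂ), (fwdDiff v)^[n] (F - G) = (fwdDiff v)^[n] F - (fwdDiff v)^[n] G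
  | 0, F, G => rfl
  | n + 1, F, G => by
    have h : fwdDiff v (F - G) = fwdDiff v F - fwdDiff v G := by funext x; simp only [fwdDiff, Pi.sub_apply]; ring
    rw [Function.iterate_succ_apply, Function.iterate_succ_apply, Function.iterate_succ_apply, h, fwdDiff_iter_sub v n]

/-- Mixed iterated differences are additive. [cite: BenfattoGiulianiMastropietro2006, (2.36aa)] -/
theorem fwdDiff_iter₂_sub (u v : X) (a b : ℕ) (F G : X → ℂ) (x : X) :
    (fwdDiff u)^[a] ((fwdDiff v)^[b] (F - G)) x = (fwdDiff u)^[a] ((fwdDiff v)^[b] F) x - (fwdDiff u)^[a] ((fwdDiff v)^[b] G) x := by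
  rw [fwdDiff_iter_sub v b, fwdDiff_iter_sub u a, Pi.sub_apply]

/-- Constants pass through mixed iterated differences (left multiplication). [cite: BenfattoGiulianiMastropietro2006, (2.36aa)] -/
theorem fwdDiff_iter₂_const_mul (u v : X) (c : ℂ) (a b : ℕ) (F : X → ℂ) (x : X) :
    (fwdDiff u)^[a] ((fwdDiff v)^[b] (fun y => c * F y)) x = c * (fwdDiff u)^[a] ((fwdDiff v)^[b] F) x := by
  have h : (fun y => c * F y) = fun y => F y * c := funext fun y => mul_comm _ _
  rw [h, fwdDiff_iter₂_mul_const, mul_comm]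

end Diff

/-! ### §3 Space differences act inside the window -/

section Space

variable {β Λ : ℝ}

/-- **Space differences of the padded symbol**: for `val q₀ < 2M` they are `(βL²)⁻²` times those of `q⃗ ↦ Ψ(ω̃_{q₀}, e(q⃗))`, and `0`
in the padding. [cite: BenfattoGiulianiMastropietro2006, (2.36aa)] -/
theorem spaceDiff_uvGridSymbolBand (v₁ v₂ : TorusSite 2 L) (a b : ℕ) (e : TorusSite 2 L → ℝ) (q₀ : TorusSite 1 N)
    (qv : TorusSite 2 L) :
    (fwdDiff v₁)^[a] ((fwdDiff v₂)^[b] (uvGridSymbolBand L M N β Λ e q₀)) qv =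
      if (q₀ 0).val < 2 * M then
        ((1 / (β * (L : ℝ) ^ 2) : ℝ) : ℂ) ^ 2 *
          (fwdDiff v₁)^[a] ((fwdDiff v₂)^[b] (fun qv => uvSymbol₂ (β * (L : ℝ) ^ 2) Λ (fbPt (gridFreq M N β q₀) (e qv)))) qv
      else 0 := by
  by_cases h : (q₀ 0).val < 2 * M
  · have hG : uvGridSymbolBand L M N β Λ e q₀ = fun qv => ((1 / (β * (L : ℝ) ^ 2) : ℝ) : ℂ) ^ 2 *
        uvSymbol₂ (β * (L : ℝ) ^ 2) Λ (fbPt (gridFreq M N β q₀) (e qv)) := by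
      funext qv'; rw [uvGridSymbolBand, if_pos h]
    rw [hG, if_pos h, fwdDiff_iter₂_const_mul]
  · have hG : uvGridSymbolBand L M N β Λ e q₀ = fun _ => (0 : ℂ) := by funext qv'; rw [uvGridSymbolBand, if_neg h]
    rw [hG, if_neg h, fwdDiff_iter_zero_fun, fwdDiff_iter_zero_fun]

/-- **Space differences of a difference of two padded symbols** (a telescoping piece). [cite: BenfattoGiulianiMastropietro2006, §3 (3.2)] -/
theorem spaceDiff_uvGridSymbolBand_sub (v₁ v₂ : TorusSite 2 L) (a b : ℕ) (e₁ e₀ : TorusSite 2 L → ℝ) (q₀ : TorusSite 1 N)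
    (qv : TorusSite 2 L) :
    (fwdDiff v₁)^[a] ((fwdDiff v₂)^[b] (uvGridSymbolBand L M N β Λ e₁ q₀ - uvGridSymbolBand L M N β Λ e₀ q₀)) qv =
      if (q₀ 0).val < 2 * M then
        ((1 / (β * (L : ℝ) ^ 2) : ℝ) : ℂ) ^ 2 *
          ((fwdDiff v₁)^[a] ((fwdDiff v₂)^[b] (fun qv => uvSymbol₂ (β * (L : ℝ) ^ 2) Λ (fbPt (gridFreq M N β q₀) (e₁ qv)))) qv -
            (fwdDiff v₁)^[a] ((fwdDiff v₂)^[b] (fun qv => uvSymbol₂ (β * (L : ℝ) ^ 2) Λ (fbPt (gridFreq M N β q₀) (e₀ qv)))) qv)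
      else 0 := by
  rw [fwdDiff_iter₂_sub, spaceDiff_uvGridSymbolBand, spaceDiff_uvGridSymbolBand]
  split_ifs with h
  · ring
  · simp

end Space

/-! ### §4 The weighted `ℓ¹` norm of the character sum telescopes -/

section Telescope

variable [NeZero L] [NeZero N]

/-- The character sum is additive in the symbol. [cite: BenfattoGiulianiMastropietro2006, §2.1 (2.3)] -/
theorem charSum_add (G H : TorusSite 1 N → TorusSite 2 L → ℂ) (a : TorusSite 1 N) (bv : TorusSite 2 L) :
    ∑ q₀ : TorusSite 1 N, ∑ qv : TorusSite 2 L, torusChar q₀ a * torusChar qv bv * (G + H) q₀ qv =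
      (∑ q₀ : TorusSite 1 N, ∑ qv : TorusSite 2 L, torusChar q₀ a * torusChar qv bv * G q₀ qv) +
        ∑ q₀ : TorusSite 1 N, ∑ qv : TorusSite 2 L, torusChar q₀ a * torusChar qv bv * H q₀ qv := by
  rw [← sum_add_distrib]
  refine sum_congr rfl fun q₀ _ => ?_
  rw [← sum_add_distrib]
  refine sum_congr rfl fun qv _ => ?_
  simp only [Pi.add_apply]; ring

/-- The character sum of a finite sum of symbols. [cite: BenfattoGiulianiMastropietro2006, §2.1 (2.3)] -/
theorem charSum_sum (D : ℕ → TorusSite 1 N → TorusSite 2 L → ℂ) (n : ℕ) (a : TorusSite 1 N) (bv : TorusSite 2 L) :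
    ∑ q₀ : TorusSite 1 N, ∑ qv : TorusSite 2 L, torusChar q₀ a * torusChar qv bv * (∑ m ∈ range n, D m) q₀ qv =
      ∑ m ∈ range n, ∑ q₀ : TorusSite 1 N, ∑ qv : TorusSite 2 L, torusChar q₀ a * torusChar qv bv * D m q₀ qv := by
  induction n with
  | zero => simp
  | succ n ih => rw [sum_range_succ, charSum_add, ih, sum_range_succ]

/-- **Telescoping the weighted `ℓ¹` norm of the character sum**: for symbols `G₀, …, Gₙ` and a non-negative weight `w`,
`Σ_{a,b⃗} w·‖S[Gₙ]‖ ≤ Σ_{a,b⃗} w·‖S[G₀]‖ + Σ_{m<n} Σ_{a,b⃗} w·‖S[G_{m+1} − Gₘ]‖`. [cite: BenfattoGiulianiMastropietro2006, §3 (3.2)–(3.8)] -/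
theorem sum_sum_wt_norm_charSum_telescope_le (w : TorusSite 1 N → TorusSite 2 L → ℝ) (hw : ∀ a bv, 0 ≤ w a bv)
    (G : ℕ → TorusSite 1 N → TorusSite 2 L → ℂ) (n : ℕ) :
    ∑ a : TorusSite 1 N, ∑ bv : TorusSite 2 L,
        w a bv * ‖∑ q₀ : TorusSite 1 N, ∑ qv : TorusSite 2 L, torusChar q₀ a * torusChar qv bv * G n q₀ qv‖ ≤
      (∑ a : TorusSite 1 N, ∑ bv : TorusSite 2 L,
          w a bv * ‖∑ q₀ : TorusSite 1 N, ∑ qv : TorusSite 2 L, torusChar q₀ a * torusChar qv bv * G 0 q₀ qv‖) +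
        ∑ m ∈ range n, ∑ a : TorusSite 1 N, ∑ bv : TorusSite 2 L,
          w a bv * ‖∑ q₀ : TorusSite 1 N, ∑ qv : TorusSite 2 L,
            torusChar q₀ a * torusChar qv bv * (G (m + 1) - G m) q₀ qv‖ := by
  have htel : G n = G 0 + ∑ m ∈ range n, (G (m + 1) - G m) := by
    rw [Finset.sum_range_sub]; abel
  rw [sum_comm (s := range n), ← sum_add_distrib]
  refine sum_le_sum fun a _ => ?_
  rw [sum_comm (s := range n), ← sum_add_distrib]
  refine sum_le_sum fun bv _ => ?_
  rw [← mul_sum, ← mul_add]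
  refine mul_le_mul_of_nonneg_left ?_ (hw a bv)
  rw [htel, charSum_add, charSum_sum]
  exact (norm_add_le _ _).trans (add_le_add le_rfl (norm_sum_le _ _))

end Telescope

/-! ### §5 The two `ℓ²` grid sums from fibrewise bounds -/

section Grid

variable [NeZero L] [NeZero N] {β Λ : ℝ}

omit [NeZero L] [NeZero N] in
/-- The extreme frequencies of the window: `val q₀ = 2M − 1` or (wrapping) `val (q₀ + u) = 0` give `|ω̃| = π(2M−1)/β`.
[cite: Salmhofer1999, §4.2.4 (4.63)] -/
theorem abs_gridFreq_of_val_eq (hβ : 0 < β) (q₀ : TorusSite 1 N) (h : (q₀ 0).val = 2 * M - 1 ∨ (q₀ 0).val = 0) (hM : 1 ≤ M) :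
    |gridFreq M N β q₀| = Real.pi * (2 * M - 1) / β := by
  unfold gridFreq
  rcases h with h | h
  · have hv : ((q₀ 0).val : ℝ) = 2 * M - 1 := by
      rw [h, Nat.cast_sub (by omega)]; push_cast; ring
    rw [hv, show (2 * (2 * (M : ℝ) - 1) - 2 * M + 1) = 2 * M - 1 by ring, abs_of_nonneg]
    have : (1 : ℝ) ≤ M := by exact_mod_cast hM
    exact div_nonneg (mul_nonneg Real.pi_pos.le (by linarith)) hβ.le
  · rw [h, Nat.cast_zero, mul_zero, zero_sub, show Real.pi * (-(2 * (M : ℝ)) + 1) / β = -(Real.pi * (2 * M - 1) / β) by ring,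
      abs_neg, abs_of_nonneg]
    have : (1 : ℝ) ≤ M := by exact_mod_cast hM
    exact div_nonneg (mul_nonneg Real.pi_pos.le (by linarith)) hβ.le

/-- At most one time index has a given value. [cite: Salmhofer1999, §4.2.4 (4.63)] -/
theorem card_filter_val_eq_le_one (r : ℕ) : (univ.filter fun q₀ : TorusSite 1 N => (q₀ 0).val = r).card ≤ 1 := by
  refine card_le_one.2 fun a ha b hb => ?_
  rw [mem_filter] at ha hb
  funext i
  rw [Fin.fin_one_eq_zero i]
  exact ZMod.val_injective N (ha.2.trans hb.2.symm)

/-- At most one time index is moved to a given value by the unit time step. [cite: Salmhofer1999, §4.2.4 (4.63)] -/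
theorem card_filter_val_add_eq_le_one (u : TorusSite 1 N) (r : ℕ) :
    (univ.filter fun q₀ : TorusSite 1 N => ((q₀ + u) 0).val = r).card ≤ 1 := by
  refine card_le_one.2 fun a ha b hb => ?_
  rw [mem_filter] at ha hb
  have h : (a + u) 0 = (b + u) 0 := ZMod.val_injective N (ha.2.trans hb.2.symm)
  funext i
  rw [Fin.fin_one_eq_zero i]
  simpa using h

/-- A sum of a non-negative constant over a filter of cardinality `≤ 1` (the edge rows of the time window). [cite: Salmhofer1999, §4.2.4 (4.63)] -/
theorem sum_ite_le_of_card_le_one {p : TorusSite 1 N → Prop} [DecidablePred p] (hp : (univ.filter p).card ≤ 1) {X : ℝ}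
    (hX : 0 ≤ X) : ∑ q₀ : TorusSite 1 N, (if p q₀ then X else 0) ≤ X := by
  rw [← sum_filter, sum_const, nsmul_eq_mul]
  calc ((univ.filter p).card : ℝ) * X ≤ 1 * X := mul_le_mul_of_nonneg_right (by exact_mod_cast hp) hX
    _ = X := one_mul X

/-- **The window `ℓ²` sum** of `T(q₀,q⃗) = [val q₀ < 2M]·c²·F(ω̃_{q₀})(q⃗)`: if `‖F(ω)(q⃗)‖ ≤ A·2/max(|ω|,Λ/2)` then
`Σ_{q₀,q⃗} ‖T‖² ≤ L²·c⁴·A²·4·(2β/Λ)` (`2M ≤ N`). [cite: BenfattoGiulianiMastropietro2006, §2.8 (2.80)] -/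
theorem sum_sum_norm_sq_window_le (hβ : 0 < β) (hΛ : 0 < Λ) (hMN : 2 * M ≤ N) (c : ℝ) (F : ℝ → TorusSite 2 L → ℂ) {A : ℝ}
    (hF : ∀ ω qv, ‖F ω qv‖ ≤ A * (2 / max |ω| (Λ / 2))) :
    ∑ q₀ : TorusSite 1 N, ∑ qv : TorusSite 2 L,
        ‖(if (q₀ 0).val < 2 * M then ((c : ℝ) : ℂ) ^ 2 * F (gridFreq M N β q₀) qv else 0)‖ ^ 2 ≤
      (L : ℝ) ^ 2 * (c ^ 4 * A ^ 2 * (4 * (2 * β / Λ))) := by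
  have hA : 0 ≤ A := by
    have h := hF 0 0
    have hE : 0 < 2 / max |(0 : ℝ)| (Λ / 2) := div_pos two_pos (lt_max_of_lt_right (by positivity))
    nlinarith [norm_nonneg (F 0 0)]
  have hpt : ∀ (q₀ : TorusSite 1 N) (qv : TorusSite 2 L),
      ‖(if (q₀ 0).val < 2 * M then ((c : ℝ) : ℂ) ^ 2 * F (gridFreq M N β q₀) qv else 0)‖ ^ 2 ≤
        if (q₀ 0).val < 2 * M then c ^ 4 * A ^ 2 * (4 * (1 / max |gridFreq M N β q₀| (Λ / 2) ^ (2 * 0 + 2))) else 0 := by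
    intro q₀ qv
    split_ifs with hq
    · rw [norm_mul, norm_pow, Complex.norm_real, Real.norm_eq_abs, mul_pow, ← pow_mul, show 2 * 2 = 4 by rfl, pow_abs,
        show |c ^ 4| = c ^ 4 from abs_of_nonneg (by positivity)]
      have h := hF (gridFreq M N β q₀) qv
      have hm : 0 < max |gridFreq M N β q₀| (Λ / 2) := lt_max_of_lt_right (by positivity)
      have h2 : ‖F (gridFreq M N β q₀) qv‖ ^ 2 ≤ (A * (2 / max |gridFreq M N β q₀| (Λ / 2))) ^ 2 :=
        pow_le_pow_left₀ (norm_nonneg _) h 2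
      calc c ^ 4 * ‖F (gridFreq M N β q₀) qv‖ ^ 2 ≤ c ^ 4 * (A * (2 / max |gridFreq M N β q₀| (Λ / 2))) ^ 2 :=
            mul_le_mul_of_nonneg_left h2 (by positivity)
        _ = c ^ 4 * A ^ 2 * (4 * (1 / max |gridFreq M N β q₀| (Λ / 2) ^ (2 * 0 + 2))) := by
            field_simp; ring
    · rw [norm_zero, zero_pow two_ne_zero]
  calc _ ≤ ∑ q₀ : TorusSite 1 N, ∑ _qv : TorusSite 2 L,
        (if (q₀ 0).val < 2 * M then c ^ 4 * A ^ 2 * (4 * (1 / max |gridFreq M N β q₀| (Λ / 2) ^ (2 * 0 + 2))) else 0) :=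
        sum_le_sum fun q₀ _ => sum_le_sum fun qv _ => hpt q₀ qv
    _ = (L : ℝ) ^ 2 * ∑ i : MatsubaraIdx M, c ^ 4 * A ^ 2 * (4 * (1 / max |matsubaraFreq β M i| (Λ / 2) ^ (2 * 0 + 2))) :=
        sum_sum_window_eq hMN β (fun ω => c ^ 4 * A ^ 2 * (4 * (1 / max |ω| (Λ / 2) ^ (2 * 0 + 2))))
    _ ≤ (L : ℝ) ^ 2 * (c ^ 4 * A ^ 2 * (4 * (2 * β / Λ))) := by
        rw [← mul_sum, ← mul_sum]
        refine mul_le_mul_of_nonneg_left (mul_le_mul_of_nonneg_left (mul_le_mul_of_nonneg_left ?_ (by norm_num))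
          (by positivity)) (by positivity)
        have h := sum_inv_uvEnv_pow_le hβ hΛ M 0
        simpa using h

/-- **The time-differenced window `ℓ²` sum**: with `T` as above, `u` the unit time step, the interior increment bound
`‖F(ω + 2π/β)(q⃗) − F(ω)(q⃗)‖ ≤ A′·2/max(|ω| − 2π/β, Λ/2)` and the value bound `‖F(ω)(q⃗)‖ ≤ A·2/max(|ω|,Λ/2)`,
`Σ_{q₀,q⃗} ‖T(q₀+u) − T(q₀)‖² ≤ L²·c⁴·(A′²·4·(4·2β/Λ + 4(2/Λ)²) + 4A²·(2/max(π(2M−1)/β, Λ/2))²)` (`1 ≤ M`, `2M ≤ N`): the interior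
rows carry the shifted envelope, the two edge rows `val q₀ ∈ {2M−1, N−1}` the extreme frequency `π(2M−1)/β`.
[cite: BenfattoGiulianiMastropietro2006, (2.36aa) and §2.8 (2.80)] -/
theorem sum_sum_norm_sq_timeDiff_window_le (hβ : 0 < β) (hΛ : 0 < Λ) (hM : 1 ≤ M) (hMN : 2 * M ≤ N) (c : ℝ)
    (F : ℝ → TorusSite 2 L → ℂ) {A A' : ℝ} (hF : ∀ ω qv, ‖F ω qv‖ ≤ A * (2 / max |ω| (Λ / 2)))
    (hF' : ∀ ω qv, ‖F (ω + 2 * Real.pi / β) qv - F ω qv‖ ≤ A' * (2 / max (|ω| - 2 * Real.pi / β) (Λ / 2))) :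
    ∑ q₀ : TorusSite 1 N, ∑ qv : TorusSite 2 L,
        ‖(if ((q₀ + fun _ : Fin 1 => (1 : ZMod N)) 0).val < 2 * M then
              ((c : ℝ) : ℂ) ^ 2 * F (gridFreq M N β (q₀ + fun _ : Fin 1 => (1 : ZMod N))) qv else 0) -
            (if (q₀ 0).val < 2 * M then ((c : ℝ) : ℂ) ^ 2 * F (gridFreq M N β q₀) qv else 0)‖ ^ 2 ≤
      (L : ℝ) ^ 2 * (c ^ 4 * (A' ^ 2 * (4 * (4 * (2 * β / Λ) + 4 * (2 / Λ) ^ 2)) +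
        4 * A ^ 2 * (2 / max (Real.pi * (2 * M - 1) / β) (Λ / 2)) ^ 2)) := by
  classical
  have hA : 0 ≤ A := by
    have h := hF 0 0
    have hE : 0 < 2 / max |(0 : ℝ)| (Λ / 2) := div_pos two_pos (lt_max_of_lt_right (by positivity))
    nlinarith [norm_nonneg (F 0 0)]
  have hA' : 0 ≤ A' := by
    have h := hF' 0 0
    have hE : 0 < 2 / max (|(0 : ℝ)| - 2 * Real.pi / β) (Λ / 2) := div_pos two_pos (lt_max_of_lt_right (by positivity))
    nlinarith [norm_nonneg (F (0 + 2 * Real.pi / β) 0 - F 0 0)]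
  have hN2 : 2 ≤ N := le_trans (by omega) hMN
  set u : TorusSite 1 N := fun _ : Fin 1 => (1 : ZMod N) with hu
  set Eext : ℝ := 2 / max (Real.pi * (2 * M - 1) / β) (Λ / 2) with hEext
  set T : TorusSite 1 N → TorusSite 2 L → ℂ := fun q₀ qv =>
    if (q₀ 0).val < 2 * M then ((c : ℝ) : ℂ) ^ 2 * F (gridFreq M N β q₀) qv else 0 with hT
  -- the value bound of `T` at a row, and its vanishing outside the window
  have hTval : ∀ q₀ qv, ‖T q₀ qv‖ ≤ if (q₀ 0).val < 2 * M then c ^ 2 * (A * (2 / max |gridFreq M N β q₀| (Λ / 2))) else 0 := by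
    intro q₀ qv
    simp only [hT]
    split_ifs with hq
    · rw [norm_mul, norm_pow, Complex.norm_real, Real.norm_eq_abs, pow_abs, show |c ^ 2| = c ^ 2 from abs_of_nonneg (sq_nonneg c)]
      exact mul_le_mul_of_nonneg_left (hF _ _) (sq_nonneg c)
    · rw [norm_zero]
  -- `val (q₀ + u) = (val q₀ + 1) % N`
  have hvalu : ∀ q₀ : TorusSite 1 N, ((q₀ + u) 0).val = ((q₀ 0).val + 1) % N := fun q₀ => by
    have h := val_add_smul_timeStep q₀ (m := 1) (by omega)
    simpa only [one_smul] using h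
  -- pointwise bound: interior rows / edge rows
  have hpt : ∀ (q₀ : TorusSite 1 N) (qv : TorusSite 2 L), ‖T (q₀ + u) qv - T q₀ qv‖ ^ 2 ≤
      (if (q₀ 0).val < 2 * M then c ^ 4 * A' ^ 2 * (4 * (1 / max (|gridFreq M N β q₀| - ((1 : ℕ) : ℝ) * (2 * Real.pi / β)) (Λ / 2) ^ (2 * 1)))
        else 0) +
      ((if ((q₀ + u) 0).val = 0 then 2 * (c ^ 2 * (A * Eext)) ^ 2 else 0) +
        (if (q₀ 0).val = 2 * M - 1 then 2 * (c ^ 2 * (A * Eext)) ^ 2 else 0)) := by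
    intro q₀ qv
    by_cases hint : (q₀ 0).val + 1 < 2 * M
    · -- interior row
      have hq : (q₀ 0).val < 2 * M := by omega
      have hqu : ((q₀ + u) 0).val = (q₀ 0).val + 1 := by rw [hvalu, Nat.mod_eq_of_lt (by omega)]
      have hqu' : ((q₀ + u) 0).val < 2 * M := by omega
      have hfreq : gridFreq M N β (q₀ + u) = gridFreq M N β q₀ + 2 * Real.pi / β := by
        have h := gridFreq_add_smul (M := M) β q₀ 1 (by omega)
        simpa only [one_smul, Nat.cast_one, one_mul] using h
      have hdiff : T (q₀ + u) qv - T q₀ qv = ((c : ℝ) : ℂ) ^ 2 * (F (gridFreq M N β q₀ + 2 * Real.pi / β) qv - F (gridFreq M N β q₀) qv) := by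
        simp only [hT, if_pos hq, if_pos hqu', hfreq]; ring
      rw [hdiff, if_pos hq, norm_mul, norm_pow, Complex.norm_real, Real.norm_eq_abs, mul_pow, ← pow_mul, show 2 * 2 = 4 by rfl,
        pow_abs, show |c ^ 4| = c ^ 4 from abs_of_nonneg (by positivity)]
      have h := hF' (gridFreq M N β q₀) qv
      have hm : 0 < max (|gridFreq M N β q₀| - 2 * Real.pi / β) (Λ / 2) := lt_max_of_lt_right (by positivity)
      have h2 := pow_le_pow_left₀ (norm_nonneg _) h 2
      have hne : 0 ≤ (c ^ 2 * (A * Eext)) ^ 2 := sq_nonneg _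
      have hedge : 0 ≤ (if ((q₀ + u) 0).val = 0 then 2 * (c ^ 2 * (A * Eext)) ^ 2 else 0) +
          (if (q₀ 0).val = 2 * M - 1 then 2 * (c ^ 2 * (A * Eext)) ^ 2 else 0) := by
        split_ifs <;> positivity
      calc c ^ 4 * ‖F (gridFreq M N β q₀ + 2 * Real.pi / β) qv - F (gridFreq M N β q₀) qv‖ ^ 2
          ≤ c ^ 4 * (A' * (2 / max (|gridFreq M N β q₀| - 2 * Real.pi / β) (Λ / 2))) ^ 2 := mul_le_mul_of_nonneg_left h2 (by positivity)
        _ = c ^ 4 * A' ^ 2 * (4 * (1 / max (|gridFreq M N β q₀| - ((1 : ℕ) : ℝ) * (2 * Real.pi / β)) (Λ / 2) ^ (2 * 1))) := by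
            rw [Nat.cast_one, one_mul]; field_simp; ring
        _ ≤ _ := le_add_of_nonneg_right hedge
    · -- edge rows: crude `‖a − b‖² ≤ 2‖a‖² + 2‖b‖²`, each value at an extreme frequency or zero
      have hcrude : ‖T (q₀ + u) qv - T q₀ qv‖ ^ 2 ≤ 2 * ‖T (q₀ + u) qv‖ ^ 2 + 2 * ‖T q₀ qv‖ ^ 2 := by
        have h := norm_sub_le (T (q₀ + u) qv) (T q₀ qv)
        nlinarith [norm_nonneg (T (q₀ + u) qv - T q₀ qv), norm_nonneg (T (q₀ + u) qv), norm_nonneg (T q₀ qv),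
          sq_nonneg (‖T (q₀ + u) qv‖ - ‖T q₀ qv‖)]
      have hint0 : 0 ≤ (if (q₀ 0).val < 2 * M then
          c ^ 4 * A' ^ 2 * (4 * (1 / max (|gridFreq M N β q₀| - ((1 : ℕ) : ℝ) * (2 * Real.pi / β)) (Λ / 2) ^ (2 * 1))) else 0) := by
        split_ifs
        · have hm : 0 < max (|gridFreq M N β q₀| - ((1 : ℕ) : ℝ) * (2 * Real.pi / β)) (Λ / 2) := lt_max_of_lt_right (by positivity)
          positivity
        · exact le_rfl
      -- value of `T q₀`: zero unless `val q₀ = 2M - 1`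
      have h0 : ‖T q₀ qv‖ ^ 2 ≤ if (q₀ 0).val = 2 * M - 1 then (c ^ 2 * (A * Eext)) ^ 2 else 0 := by
        by_cases hq : (q₀ 0).val < 2 * M
        · have hval : (q₀ 0).val = 2 * M - 1 := by omega
          rw [if_pos hval]
          have h := hTval q₀ qv
          rw [if_pos hq, abs_gridFreq_of_val_eq hβ q₀ (Or.inl hval) hM] at h
          exact pow_le_pow_left₀ (norm_nonneg _) h 2
        · have hz : T q₀ qv = 0 := by simp only [hT, if_neg hq]
          rw [hz, norm_zero, zero_pow two_ne_zero]
          split_ifs <;> positivity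
      -- value of `T (q₀ + u)`: zero unless `val (q₀ + u) = 0`
      have h1 : ‖T (q₀ + u) qv‖ ^ 2 ≤ if ((q₀ + u) 0).val = 0 then (c ^ 2 * (A * Eext)) ^ 2 else 0 := by
        by_cases hq : ((q₀ + u) 0).val < 2 * M
        · have hval : ((q₀ + u) 0).val = 0 := by
            have hv := hvalu q₀
            by_contra hne
            have hlt : (q₀ 0).val + 1 < N := by
              by_contra hge
              have heq : (q₀ 0).val + 1 = N := by have := ZMod.val_lt (q₀ 0); omega
              rw [heq, Nat.mod_self] at hv
              exact hne hv
            rw [Nat.mod_eq_of_lt hlt] at hv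
            omega
          rw [if_pos hval]
          have h := hTval (q₀ + u) qv
          rw [if_pos hq, abs_gridFreq_of_val_eq hβ (q₀ + u) (Or.inr hval) hM] at h
          exact pow_le_pow_left₀ (norm_nonneg _) h 2
        · have hz : T (q₀ + u) qv = 0 := by simp only [hT, if_neg hq]
          rw [hz, norm_zero, zero_pow two_ne_zero]
          split_ifs <;> positivity
      have h0' : 2 * ‖T q₀ qv‖ ^ 2 ≤ if (q₀ 0).val = 2 * M - 1 then 2 * (c ^ 2 * (A * Eext)) ^ 2 else 0 := by
        split_ifs with h <;> simp only [h, if_true, if_false] at h0 <;> linarith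
      have h1' : 2 * ‖T (q₀ + u) qv‖ ^ 2 ≤ if ((q₀ + u) 0).val = 0 then 2 * (c ^ 2 * (A * Eext)) ^ 2 else 0 := by
        split_ifs with h <;> simp only [h, if_true, if_false] at h1 <;> linarith
      linarith
  -- sum the pointwise bound
  have hL2 : Fintype.card (TorusSite 2 L) = L ^ 2 := by rw [Fintype.card_fun, ZMod.card, Fintype.card_fin]
  have hX : 0 ≤ 2 * (c ^ 2 * (A * Eext)) ^ 2 := by positivity
  calc _ = ∑ q₀ : TorusSite 1 N, ∑ qv : TorusSite 2 L, ‖T (q₀ + u) qv - T q₀ qv‖ ^ 2 := by simp only [hT, hu]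
    _ ≤ ∑ q₀ : TorusSite 1 N, ∑ _qv : TorusSite 2 L,
          ((if (q₀ 0).val < 2 * M then
              c ^ 4 * A' ^ 2 * (4 * (1 / max (|gridFreq M N β q₀| - ((1 : ℕ) : ℝ) * (2 * Real.pi / β)) (Λ / 2) ^ (2 * 1))) else 0) +
            ((if ((q₀ + u) 0).val = 0 then 2 * (c ^ 2 * (A * Eext)) ^ 2 else 0) +
              (if (q₀ 0).val = 2 * M - 1 then 2 * (c ^ 2 * (A * Eext)) ^ 2 else 0))) :=
        sum_le_sum fun q₀ _ => sum_le_sum fun qv _ => hpt q₀ qv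
    _ = (∑ q₀ : TorusSite 1 N, ∑ _qv : TorusSite 2 L,
            (if (q₀ 0).val < 2 * M then
              c ^ 4 * A' ^ 2 * (4 * (1 / max (|gridFreq M N β q₀| - ((1 : ℕ) : ℝ) * (2 * Real.pi / β)) (Λ / 2) ^ (2 * 1))) else 0)) +
          ∑ q₀ : TorusSite 1 N, ((L : ℝ) ^ 2 * (if ((q₀ + u) 0).val = 0 then 2 * (c ^ 2 * (A * Eext)) ^ 2 else 0) +
            (L : ℝ) ^ 2 * (if (q₀ 0).val = 2 * M - 1 then 2 * (c ^ 2 * (A * Eext)) ^ 2 else 0)) := by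
        rw [← sum_add_distrib]
        refine sum_congr rfl fun q₀ _ => ?_
        simp only [sum_add_distrib, sum_const, card_univ, hL2, nsmul_eq_mul]
        push_cast
        ring
    _ ≤ (L : ℝ) ^ 2 * (c ^ 4 * A' ^ 2 * (4 * (4 ^ 1 * ((2 / Λ) ^ (2 * 1 - 2) * (2 * β / Λ)) + 4 * ((1 : ℕ) : ℝ) * (2 / Λ) ^ (2 * 1)))) +
          ((L : ℝ) ^ 2 * (2 * (c ^ 2 * (A * Eext)) ^ 2) + (L : ℝ) ^ 2 * (2 * (c ^ 2 * (A * Eext)) ^ 2)) := by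
        refine add_le_add ?_ ?_
        · rw [sum_sum_window_eq hMN β (fun ω => c ^ 4 * A' ^ 2 *
              (4 * (1 / max (|ω| - ((1 : ℕ) : ℝ) * (2 * Real.pi / β)) (Λ / 2) ^ (2 * 1)))), ← mul_sum, ← mul_sum]
          refine mul_le_mul_of_nonneg_left (mul_le_mul_of_nonneg_left (mul_le_mul_of_nonneg_left ?_ (by norm_num))
            (by positivity)) (by positivity)
          exact sum_inv_uvEnvShift_pow_le hβ hΛ M 1 (n := 1) le_rfl
        · rw [sum_add_distrib, ← mul_sum, ← mul_sum]
          exact add_le_add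
            (mul_le_mul_of_nonneg_left (sum_ite_le_of_card_le_one (card_filter_val_add_eq_le_one u 0) hX) (by positivity))
            (mul_le_mul_of_nonneg_left (sum_ite_le_of_card_le_one (card_filter_val_eq_le_one (2 * M - 1)) hX) (by positivity))
    _ = (L : ℝ) ^ 2 * (c ^ 4 * (A' ^ 2 * (4 * (4 * (2 * β / Λ) + 4 * (2 / Λ) ^ 2)) + 4 * A ^ 2 * Eext ^ 2)) := by
        simp only [pow_one, Nat.cast_one, show 2 * 1 - 2 = 0 by rfl, pow_zero, one_mul, mul_one]
        ring

end Grid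

end Literature.MathematicalPhysics.QuantumLattice

end
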